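import Literature.NumberTheory.LFunctions.ExplicitDeuringHeilbronnDirichletFamily
import Literature.NumberTheory.LFunctions.LinnikConstantRecords
import Literature.Barriers.Parity.SiegelZeroDichotomyProofs
import HarnessLib

/-!
# A Siegel zero repels the whole family `q ≤ Q`: Thorner–Zaman's explicit Deuring–Heilbronn
# Theorem 2.15 read on the column's predicate `IsSiegelZero` (PROVED only; debt 0)

Topic `Literature/NumberTheory/LFunctions`. Typed for the cell `parity-realchar` (SIEGEL INSTRUMENT,
deliverable (3) «illusory-world conditionals», topic I.8 «Deuring–Heilbronn repulsion, explicit»).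
The named fact is the tree's `thornerZaman2024_theorem215` (Thorner–Zaman, Forum Math. 36 (2024),
Theorem 2.15, typed by the cell `landau-siegel` in `ExplicitDeuringHeilbronnDirichletFamily.lean` on
the objects `ThornerZaman2024.betaOne Q = β₁(Q)` of `ExplicitLogFreeZeroDensityDirichlet.lean`,
`dhBound Q T β₁ = 1 − log(1/((1−β₁)·dhInner Q T))/dhDenom Q T`, `zfrConst = 1/9.645 908 801`): if
`β₁(Q) ≥ 1 − c_ZFR/log Q` (`Q > 400 000`, `T ≥ 1`) then every other zero `ρ` of every primitive
`L(s,χ)`, `q ≤ Q`, with `Re ρ > 1/2`, `|Im ρ| ≤ T` has `Re ρ ≤ dhBound Q T (β₁(Q))`.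

This file PROVES:

* bookkeeping on `β₁(Q) = sSup (realZeroSet Q)` that the tree did not yet have:
  `ThornerZaman2024.realZeroSet_lt_one` (every real zero of a primitive `L(s,χ)` — and of `ζ` — is
  `< 1`: Mathlib's non-vanishing on `Re s ≥ 1`), `bddAbove_realZeroSet`, `betaOne_le_one`
  (`β₁(Q) ≤ 1` for `Q ≥ 1`; print: "`β₁(Q) ∈ [0,1)`"), and `le_betaOne` (a real zero of a primitive
  character of modulus `q ≤ Q` is `≤ β₁(Q)`);
* `IsSiegelZero.le_betaOne` — a Siegel zero `β = 1 − 1/(η log q)` (Tao–Teräväinen, Definition 1.4)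
  at a conductor `q ≤ Q` satisfies `β ≤ β₁(Q)`; hence (`IsSiegelZero.betaOne_hypothesis`) the
  hypothesis `β₁(Q) ≥ 1 − c_ZFR/log Q` of Theorem 2.15 holds as soon as `η log q ≥ log Q/c_ZFR`
  (quality `η ≥ 9.645 908 801 · log Q/log q`);
* **`IsSiegelZero.familyRepulsion_of_theorem215`** — modulo the named fact and the printed side remark
  `β₁(Q) < 1`: such a Siegel zero REPELS every other zero `ρ ≠ β₁(Q)`, `ρ ≠ 1`, of every primitive
  `L(s,χ')` of modulus `q' ≤ Q` with `Re ρ > 1/2`, `|Im ρ| ≤ T`: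
  `Re ρ ≤ 1 − log(η log q/dhInner Q T)/dhDenom Q T`
  (`dhInner = 670 564.676 + 347 029.502 log Q + 107 906.278 log T`,
  `dhDenom = 104.645 + 54.156 log Q + 16.84 log T`), using `0 < 1 − β₁(Q) ≤ 1 − β = 1/(η log q)`
  and the monotonicity of `log`. The side hypothesis `β₁(Q) < 1` ("Thus `β₁(Q) ∈ [0,1)`", Remark
  after Theorem 1.2) is, for the tree's `sSup` rendering, the isolation of zeros of the finitely many
  `L(s,χ)`; it is taken as an input here (`betaOne_le_one` gives `≤ 1`).

* (appended) `IsSiegelZero.linnikBox_of_heathBrown1992` — READING of Heath-Brown 1992, Theorem 4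
  (the [LS] fact `heathBrown1992_theorem4`, `LinnikConstantRecords.lean`): for `q ≥ q₀(ε)` a Siegel
  zero of quality `η` is the only zero of `∏ L(s,χ′)` (mod `q`) in
  `σ ≥ 1 − min{(12/11 − ε) log η, (1/3) log log log q}/log q`, `|t| ≤ 1`.

LABEL (cell rule): instrument / statement-layer glue. WHAT THIS IS NOT: no claim that a Siegel zero
exists; nothing here bears on the parity summit.

## References

* [ThornerZaman2024LogFree] J. Thorner, A. Zaman, *An explicit version of Bombieri's log-free
  density estimate and Sárközy's theorem for shifted primes*, Forum Math. 36 (2024) — Theorem 2.15,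
  Lemma 2.3 (`c_ZFR`), §1 (display defining `β₁(Q)`) and the Remark after Theorem 1.2.
* [TaoTeravainen2021] T. Tao, J. Teräväinen, JLMS 106 (2022), Definition 1.4 (quality `η`).
* [HeathBrown1992PLMS] D. R. Heath-Brown, PLMS (3) 64 (1992) 265–338, Theorem 4 (tree:
  `heathBrown1992_theorem4`).
-/

noncomputable section

open Literature.Barriers.Parity

namespace Literature.NumberTheory.LFunctions

namespace ThornerZaman2024

/-- The real zeros of `𝓛(s,Q)` are `< 1`: `L(σ,χ) ≠ 0` for real `σ ≥ 1` (Mathlib's non-vanishing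
on `Re s ≥ 1`; for `ζ` at `s = 1` the Mathlib value `riemannZeta 1` is non-zero as well).
[cite: ThornerZaman2024LogFree, Remark after Theorem 1.2 ("β₁(Q) ∈ [0,1)")] -/
theorem realZeroSet_lt_one {Q β : ℝ} (hβ : β ∈ realZeroSet Q) : β < 1 := by
  obtain ⟨i, _, χ, hprim, hzero⟩ := hβ
  by_contra hge
  rw [not_lt] at hge
  have hre : 1 ≤ ((β : ℂ)).re := by simpa using hge
  rcases eq_or_ne χ 1 with hχ | hχ
  · -- `χ = 1` primitive ⇒ modulus `1`, `L(s, 1) = ζ(s)`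
    have hi : i = 0 := by
      have hc : χ.conductor = i + 1 := hprim
      rw [hχ, DirichletCharacter.conductor_one] at hc
      omega
    subst hi
    rw [hχ] at hzero
    rcases eq_or_ne β 1 with hβ1 | hβ1
    · rw [hβ1, Complex.ofReal_one, DirichletCharacter.LFunction_modOne_eq] at hzero
      exact riemannZeta_one_ne_zero hzero
    · exact DirichletCharacter.LFunction_ne_zero_of_one_le_re (1 : DirichletCharacter ℂ (0 + 1))
        (s := (β : ℂ)) (Or.inr (by exact_mod_cast hβ1)) hre hzero
  · exact DirichletCharacter.LFunction_ne_zero_of_one_le_re χ (s := (β : ℂ)) (Or.inl hχ) hre hzero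

/-- `realZeroSet Q` is bounded above (by `1`). [cite: ThornerZaman2024LogFree, Remark after Theorem 1.2] -/
theorem bddAbove_realZeroSet (Q : ℝ) : BddAbove (realZeroSet Q) :=
  ⟨1, fun _ hβ => (realZeroSet_lt_one hβ).le⟩

/-- `β₁(Q) ≤ 1` for `Q ≥ 1` (print: "`β₁(Q) ∈ [0,1)`"; the tree's `sSup` rendering gives `≤ 1`
from `realZeroSet_lt_one`). [cite: ThornerZaman2024LogFree, Remark after Theorem 1.2] -/
theorem betaOne_le_one {Q : ℝ} (hQ : 1 ≤ Q) : betaOne Q ≤ 1 :=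
  csSup_le (realZeroSet_nonempty hQ) fun _ hb => (realZeroSet_lt_one hb).le

/-- A real zero of a primitive character of modulus `q ≤ Q` is `≤ β₁(Q)`.
[cite: ThornerZaman2024LogFree, §1 (display defining β₁(Q))] -/
theorem le_betaOne {Q : ℝ} {q : ℕ} [NeZero q] (hq : (q : ℝ) ≤ Q)
    {χ : DirichletCharacter ℂ q} (hprim : χ.IsPrimitive) {β : ℝ} (hzero : χ.LFunction β = 0) :
    β ≤ betaOne Q := by
  obtain ⟨k, rfl⟩ : ∃ k, q = k + 1 := Nat.exists_eq_succ_of_ne_zero (NeZero.ne q)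
  have hk : k < ⌊Q⌋₊ := by
    have : k + 1 ≤ ⌊Q⌋₊ := Nat.le_floor hq
    omega
  exact le_csSup (bddAbove_realZeroSet Q) ⟨k, hk, χ, hprim, hzero⟩

end ThornerZaman2024

open ThornerZaman2024

/-- **A Siegel zero lies below `β₁(Q)`**: for a Siegel zero of quality `η` attached to `χ mod q`
(`β = 1 − 1/(η log q)`, `χ` primitive) with `q ≤ Q`, `β ≤ β₁(Q)`.
[cite: ThornerZaman2024LogFree, §1 (display defining β₁(Q))] [cite: TaoTeravainen2021, Definition 1.4] -/
theorem _root_.Literature.Barriers.Parity.IsSiegelZero.le_betaOne {Q : ℝ} {q : ℕ} [NeZero q]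
    (hqQ : (q : ℝ) ≤ Q) {χ : DirichletCharacter ℂ q} {η : ℝ} (hS : IsSiegelZero χ η) :
    1 - 1 / (η * Real.log q) ≤ betaOne Q :=
  ThornerZaman2024.le_betaOne hqQ hS.1 hS.2.2.2

/-- **The hypothesis of Theorem 2.15 from a Siegel zero of quality `η ≥ 9.645 908 801 · log Q/log q`**
(`η log q ≥ log Q/c_ZFR`): then `β₁(Q) ≥ β = 1 − 1/(η log q) ≥ 1 − c_ZFR/log Q`.
[cite: ThornerZaman2024LogFree, Theorem 2.15 (hypothesis) and Lemma 2.3] [cite: TaoTeravainen2021, Definition 1.4] -/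
theorem _root_.Literature.Barriers.Parity.IsSiegelZero.betaOne_hypothesis {Q : ℝ} (hQ : 1 < Q)
    {q : ℕ} [NeZero q] (hqQ : (q : ℝ) ≤ Q) {χ : DirichletCharacter ℂ q} {η : ℝ}
    (hS : IsSiegelZero χ η) (hη : Real.log Q / zfrConst ≤ η * Real.log q) :
    1 - zfrConst / Real.log Q ≤ betaOne Q := by
  have hq3 : 3 ≤ q := hS.three_le
  have hlogq : 0 < Real.log q := Real.log_pos (by exact_mod_cast (show 1 < q by omega))
  have hlogQ : 0 < Real.log Q := Real.log_pos hQ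
  have hηpos : 0 < η := by linarith [hS.ten_le]
  have hηq : 0 < η * Real.log q := mul_pos hηpos hlogq
  have hβle := hS.le_betaOne hqQ
  have hczle : 1 / (η * Real.log q) ≤ zfrConst / Real.log Q := by
    rw [div_le_div_iff₀ hηq hlogQ, one_mul]
    have hzpos : 0 < zfrConst := by unfold zfrConst; norm_num
    have := (div_le_iff₀ hzpos).mp hη
    linarith
  linarith

/-- **A Siegel zero repels the whole family `q ≤ Q`** (READING of Thorner–Zaman's Theorem 2.15,
modulo the named fact `thornerZaman2024_theorem215` and the printed side remark `β₁(Q) < 1`): for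
`Q > 400 000`, `T ≥ 1`, a Siegel zero of quality `η` attached to `χ mod q`, `q ≤ Q`, with
`η log q ≥ log Q/c_ZFR`, and any zero `ρ ≠ 1`, `ρ ≠ β₁(Q)` of a primitive `L(s,χ')` of modulus
`q' ≤ Q` with `Re ρ > 1/2`, `|Im ρ| ≤ T`:
`Re ρ ≤ 1 − log(η log q/dhInner Q T)/dhDenom Q T`, i.e.
`Re ρ ≤ 1 − log(η log q/(670 564.676 + 347 029.502 log Q + 107 906.278 log T))/(104.645 + 54.156 log Q + 16.84 log T)`
— from `Re ρ ≤ dhBound Q T (β₁(Q))` and `0 < 1 − β₁(Q) ≤ 1 − β = 1/(η log q)`.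
[cite: ThornerZaman2024LogFree, Theorem 2.15 and Remark after Theorem 1.2] [cite: TaoTeravainen2021, Definition 1.4] -/
theorem _root_.Literature.Barriers.Parity.IsSiegelZero.familyRepulsion_of_theorem215
    (h215 : thornerZaman2024_theorem215) {Q : ℝ} (hQ : 400000 < Q) (hβ₁ : betaOne Q < 1)
    {T : ℝ} (hT : 1 ≤ T) {q : ℕ} [NeZero q] (hqQ : (q : ℝ) ≤ Q) {χ : DirichletCharacter ℂ q}
    {η : ℝ} (hS : IsSiegelZero χ η) (hη : Real.log Q / zfrConst ≤ η * Real.log q)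
    {q' : ℕ} [NeZero q'] (hq'Q : (q' : ℝ) ≤ Q) {χ' : DirichletCharacter ℂ q'} (hprim' : χ'.IsPrimitive)
    {ρ : ℂ} (hρ1 : ρ ≠ 1) (hne : ρ ≠ ((betaOne Q : ℝ) : ℂ)) (hzero : χ'.LFunction ρ = 0)
    (hre : 1 / 2 < ρ.re) (him : |ρ.im| ≤ T) :
    ρ.re ≤ 1 - Real.log (η * Real.log q / dhInner Q T) / dhDenom Q T := by
  have hq3 : 3 ≤ q := hS.three_le
  have hlogq : 0 < Real.log q := Real.log_pos (by exact_mod_cast (show 1 < q by omega))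
  have hηpos : 0 < η := by linarith [hS.ten_le]
  have hηq : 0 < η * Real.log q := mul_pos hηpos hlogq
  have hQ1 : 1 ≤ Q := by linarith
  have hhyp : 1 - zfrConst / Real.log Q ≤ betaOne Q := hS.betaOne_hypothesis (by linarith) hqQ hη
  have hmain : ρ.re ≤ dhBound Q T (betaOne Q) :=
    h215 Q T hQ hT hhyp q' χ' hq'Q hprim' ρ hρ1 hne hzero hre him
  have hIpos : 0 < dhInner Q T := dhInner_pos hQ1 hT
  have hDpos : 0 < dhDenom Q T := dhDenom_pos hQ1 hT
  have h1β : 0 < 1 - betaOne Q := by linarith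
  have hle1 : 1 - betaOne Q ≤ 1 / (η * Real.log q) := by linarith [hS.le_betaOne hqQ]
  -- `η log q / I ≤ 1/((1 − β₁) I)` since `(1 − β₁) η log q ≤ 1`
  have hprod : (1 - betaOne Q) * (η * Real.log q) ≤ 1 := by
    calc (1 - betaOne Q) * (η * Real.log q)
        ≤ 1 / (η * Real.log q) * (η * Real.log q) := mul_le_mul_of_nonneg_right hle1 hηq.le
      _ = 1 := by field_simp
  have hkey : η * Real.log q / dhInner Q T ≤ 1 / ((1 - betaOne Q) * dhInner Q T) := by
    rw [div_le_div_iff₀ hIpos (mul_pos h1β hIpos)]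
    nlinarith [hprod, hIpos]
  have hlog : Real.log (η * Real.log q / dhInner Q T) ≤
      Real.log (1 / ((1 - betaOne Q) * dhInner Q T)) :=
    Real.log_le_log (by positivity) hkey
  have hdiv : Real.log (η * Real.log q / dhInner Q T) / dhDenom Q T ≤
      Real.log (1 / ((1 - betaOne Q) * dhInner Q T)) / dhDenom Q T :=
    div_le_div_of_nonneg_right hlog hDpos.le
  have hunfold : dhBound Q T (betaOne Q) =
      1 - Real.log (1 / ((1 - betaOne Q) * dhInner Q T)) / dhDenom Q T := rfl
  linarith [hmain, hdiv, hunfold]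

/-! ### Heath-Brown's Theorem 4 (Deuring–Heilbronn in the Linnik box, constant `12/11 − ε`) read
on `IsSiegelZero` (appended 2026-08-26)

The named fact is the tree's `heathBrown1992_theorem4` (Heath-Brown, PLMS 64 (1992), Theorem 4,
typed by the cell `landau-siegel` in `LinnikConstantRecords.lean`, box `|t| ≤ 1`): for `ε > 0` and
`q ≥ q₀(ε)`, a real zero `1 − λ/log q`, `λ ≤ 0.348`, of a real non-principal `χ` mod `q` is the ONLY
zero of `∏_{χ′ mod q} L(s,χ′)` in `σ ≥ 1 − min{(12/11 − ε) log λ⁻¹, (1/3) log log log q}/log q`,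
`|t| ≤ 1`. For a Siegel zero of quality `η` (Tao–Teräväinen: `β = 1 − 1/(η log q)`, `η ≥ 10`) one has
`λ = 1/η ≤ 0.1 ≤ 0.348` and `log λ⁻¹ = log η`. -/

/-- **A Siegel zero of quality `η` clears the Linnik box to depth `(12/11 − ε) log η/log q`**
(READING of Heath-Brown's Theorem 4, modulo the named fact `heathBrown1992_theorem4`): for every
`ε > 0` there is `q₀` such that for every `q ≥ q₀` and every Siegel zero of quality `η` attached to
`χ mod q` (`β = 1 − 1/(η log q)`), every zero `ρ ≠ 1` of any `L(s,χ′)`, `χ′ mod q`, with `|Im ρ| ≤ 1`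
and `Re ρ ≥ 1 − min{(12/11 − ε) log η, (1/3) log log log q}/log q` is the Siegel zero itself:
`χ′ = χ` and `ρ = β`. (Asymptotic in `q`; the explicit single-modulus form is Benli–Goel–Twiss–Zaman's
`BGTZ2025.corollary11`, the explicit family form `IsSiegelZero.familyRepulsion_of_theorem215` above.)
[cite: HeathBrown1992PLMS, Theorem 4] [cite: TaoTeravainen2021, Definition 1.4] -/
theorem _root_.Literature.Barriers.Parity.IsSiegelZero.linnikBox_of_heathBrown1992
    (h4 : heathBrown1992_theorem4) {ε : ℝ} (hε : 0 < ε) :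
    ∃ q₀ : ℕ, ∀ (q : ℕ) [NeZero q], q₀ ≤ q →
      ∀ (χ : DirichletCharacter ℂ q) (η : ℝ), IsSiegelZero χ η →
        ∀ (χ' : DirichletCharacter ℂ q) (ρ : ℂ), χ'.LFunction ρ = 0 → ρ ≠ 1 → |ρ.im| ≤ 1 →
          1 - min ((12 / 11 - ε) * Real.log η) (1 / 3 * Real.log (Real.log (Real.log q))) /
              Real.log q ≤ ρ.re →
            χ' = χ ∧ ρ = ((1 - 1 / (η * Real.log q) : ℝ) : ℂ) := by
  obtain ⟨q₀, h⟩ := h4 ε hε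
  refine ⟨q₀, fun q _ hq χ η hS χ' ρ hzero hρ1 him hre => ?_⟩
  have hq3 : 3 ≤ q := hS.three_le
  obtain ⟨hprim, hquad, h10, hz⟩ := hS
  have hηpos : 0 < η := by linarith
  have hne : χ ≠ 1 := by
    intro h1
    rw [DirichletCharacter.isPrimitive_def, h1, DirichletCharacter.conductor_one] at hprim
    omega
  -- `λ = 1/η`: `0 < λ ≤ 0.348`, `log(1/λ) = log η`, `1 − λ/log q = 1 − 1/(η log q)`
  have hlam : (1 : ℝ) / η ≤ 0.348 := by
    rw [div_le_iff₀ hηpos]; nlinarith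
  have hloglam : Real.log (1 / (1 / η)) = Real.log η := by rw [one_div_one_div]
  have hβ : (1 - (1 / η) / Real.log q : ℝ) = 1 - 1 / (η * Real.log q) := by rw [div_div]
  have hcast : (1 : ℂ) - ((1 / η : ℝ) : ℂ) / ((Real.log q : ℝ) : ℂ) =
      (((1 - 1 / (η * Real.log q) : ℝ)) : ℂ) := by
    push_cast
    rw [div_div]
  have hz' : χ.LFunction (1 - ((1 / η : ℝ) : ℂ) / ((Real.log q : ℝ) : ℂ)) = 0 := by
    rw [hcast]; exact hz
  have hre' : 1 - min ((12 / 11 - ε) * Real.log (1 / (1 / η)))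
      (1 / 3 * Real.log (Real.log (Real.log q))) / Real.log q ≤ ρ.re := by
    rw [hloglam]; exact hre
  obtain ⟨hχ, hρ⟩ := h q hq χ (1 / η) hne hquad (by positivity) hlam hz' χ' ρ hzero hρ1 him hre'
  exact ⟨hχ, by rw [hρ, hβ]⟩

end Literature.NumberTheory.LFunctions

end
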